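import Literature.Geometry.Riemannian.HeatKernelBasePointSmooth
import HarnessLib

/-!
# The heat kernel `K(x,t;y,s)` of a Ricci flow on a closed connected manifold
# (Bamler 2020a, §2.3): one function with all its properties

R. Bamler, *Entropy and heat kernel bounds on a Ricci flow background*, arXiv:2008.07093 (2020a),
§2.3: for a Ricci flow `(g_t)` on a closed manifold and `s < t` there is a heat kernel
`K(x,t;y,s) > 0`, smooth, with `dν_{x,t;s} = K(x,t;·,s) dg_s`, solving the conjugate heat equation
`−∂ₛK = Δ_{y,g_s}K − R K` in `(y, s)` and the heat equation `∂ₜK = Δ_{x,g_t}K` in `(x, t)`, with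
the reproduction formula `K(x,t;y,s) = ∫ K(x,t;z,r) K(z,r;y,s) dg_r(z)`.

* `IsRicciFlow.exists_heatKernelFn` — for a Ricci flow on `[a, T]` on a closed connected manifold
  there is `𝒦 : ℝ → M → M × ℝ → ℝ` (`𝒦 t x (y, s) = K(x,t;y,s)`) such that for every base time
  `t ∈ (a, T]`: `𝒦 t x` is `C^∞` and `> 0` on `M × (a, t)`, is the density of `ν_{x,t;s}` for every
  `s ∈ (a, t)`, solves `∂ₛ = −Δ_{h(s)} + R`, is Lipschitz in `x` on compact sub-slabs and jointly
  continuous in `(x, y, s)`; for every `s ∈ (a, T)` and `y`: `(x, t) ↦ 𝒦 t x (y, s)` is `C^∞` on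
  `M × (s, T)` with `∂ₜ = Δ_{h(t)}`, `((x, t), y) ↦ 𝒦 t x (y, s)` is continuous on
  `(M × (s, T]) × M`; and the reproduction formulas
  `𝒦 t x (y, s) = ∫ 𝒦 r z (y, s) dν_{x,t;r}(z) = ∫ 𝒦 t x (z, r) 𝒦 r z (y, s) dV_{h(r)}(z)` hold
  for `a < s < r < t ≤ T`.

This assembles `IsRicciFlow.exists_conjugateHeatKernel_timeFamily`,
`continuousOn_conjugateHeatKernel_timeFamily`, `conjugateHeatKernel_family_reproduction` and
`contMDiffOn_and_deriv_conjugateHeatKernel_timeFamily_basePoint`. Everything is proved; no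
definitions, no named facts.

## References

* R. H. Bamler, *Entropy and heat kernel bounds on a Ricci flow background*, arXiv:2008.07093
  (2020), §2.3. [Bamler2020Entropy]
-/

noncomputable section

open Bundle Set Function Filter Manifold MeasureTheory Measure TopologicalSpace
open scoped Manifold ContDiff Topology ENNReal NNReal

namespace Literature.Geometry.Riemannian

open Lorentzian Lorentzian.PseudoRiemannianMetric

section HeatKernelFn

variable {m : ℕ} {H : Type*} [TopologicalSpace H]
  {I : ModelWithCorners ℝ (EuclideanSpace ℝ (Fin m)) H} [I.Boundaryless]
  {M : Type*} [TopologicalSpace M] [ChartedSpace H M] [IsManifold I ∞ M]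
  [T2Space M] [CompactSpace M] [SecondCountableTopology M] [MeasurableSpace M] [BorelSpace M]
  {h : ℝ → PseudoRiemannianMetric I ∞ (EuclideanSpace ℝ (Fin m)) (TangentSpace I : M → Type _)}
  {cov : ℝ → CovariantDerivative I (EuclideanSpace ℝ (Fin m)) (TangentSpace I : M → Type _)}
  (hh : IsContMDiffFamilyOn ∞ h univ) (hR : ∀ r, (h r).IsRiemannian)

include hh hR in
/-- **The reproduction formula with densities** (Bamler 2020a, §2.3,
`K(x,t;y,s) = ∫ K(x,t;z,r) K(z,r;y,s) dg_r(z)`): for nonnegative jointly continuous density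
families `𝒦 t` (base time `t`) and `𝒦 r` (base time `r`), `a < s < r < t`,
`𝒦 t x (y, s) = ∫ 𝒦 t x (z, r) 𝒦 r z (y, s) dV_{h(r)}(z)` (`conjugateHeatKernel_family_reproduction`
and `ν_{x,t;r} = 𝒦 t x (·, r) dV_{h(r)}`). [cite: Bamler2020Entropy, §2.3] -/
theorem conjugateHeatKernel_family_semigroup {a r t : ℝ} (har : a < r) (hrt : r < t)
    {K : M → M × ℝ → ℝ} (hK0 : ∀ x, ∀ p ∈ univ ×ˢ Ioo a t, 0 ≤ K x p)
    (hKν : ∀ x, ∀ s ∈ Ioo a t, heatKernelMeasure hh hR t x s =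
      (h s).riemVolume.withDensity fun y ↦ ENNReal.ofReal (K x (y, s)))
    (hKc : ContinuousOn (fun q : M × (M × ℝ) ↦ K q.1 q.2) (univ ×ˢ (univ ×ˢ Ioo a t)))
    {K' : M → M × ℝ → ℝ} (hK'0 : ∀ z, ∀ p ∈ univ ×ˢ Ioo a r, 0 ≤ K' z p)
    (hK'ν : ∀ z, ∀ s ∈ Ioo a r, heatKernelMeasure hh hR r z s =
      (h s).riemVolume.withDensity fun y ↦ ENNReal.ofReal (K' z (y, s)))
    (hK'c : ContinuousOn (fun q : M × (M × ℝ) ↦ K' q.1 q.2) (univ ×ˢ (univ ×ˢ Ioo a r)))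
    (x : M) {s : ℝ} (hs : s ∈ Ioo a r) (y : M) :
    K x (y, s) = ∫ z, K x (z, r) * K' z (y, s) ∂(h r).riemVolume := by
  have hr : r ∈ Ioo a t := ⟨har, hrt⟩
  rw [conjugateHeatKernel_family_reproduction hh hR hrt hK0 hKν hKc hK'0 hK'ν hK'c x hs y,
    hKν x r hr]
  have hc : Continuous fun z ↦ K x (z, r) :=
    hKc.comp_continuous (continuous_const.prodMk (continuous_id.prodMk continuous_const))
      fun _ ↦ ⟨mem_univ _, mem_univ _, hr⟩
  rw [integral_withDensity_eq_integral_toReal_smul hc.measurable.ennreal_ofReal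
    (Eventually.of_forall fun _ ↦ ENNReal.ofReal_lt_top)]
  refine integral_congr_ae (Eventually.of_forall fun z ↦ ?_)
  show (ENNReal.ofReal (K x (z, r))).toReal • K' z (y, s) = K x (z, r) * K' z (y, s)
  rw [ENNReal.toReal_ofReal (hK0 x _ ⟨mem_univ _, hr⟩), smul_eq_mul]

include hh hR in
/-- **The heat kernel of a Ricci flow on a closed connected manifold** (Bamler 2020a, §2.3). Let
`h` be a `C^∞` family of Riemannian metrics on the closed connected manifold `M` (modelled on
`ℝᵐ`) which is a Ricci flow `(h, cov)` on `[a, T]`. There is `𝒦 : ℝ → M → M × ℝ → ℝ`,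
`𝒦 t x (y, s) = K(x,t;y,s)`, such that:
(1) for every base time `t ∈ (a, T]`, `𝒦 t x` is `C^∞` and strictly positive on `M × (a, t)`,
`ν_{x,t;s} = 𝒦 t x (·, s) dV_{h(s)}` for all `s ∈ (a, t)`,
`∂ₛ 𝒦 t x (y, s) = −Δ_{h(s)}(𝒦 t x (·, s))(y) + R(y, s) 𝒦 t x (y, s)`, `𝒦 t` is Lipschitz in
`x` for `d_{h(t)}` on compact sub-slabs and `(x, y, s) ↦ 𝒦 t x (y, s)` is continuous;
(2) for every `s ∈ (a, T)` and `y`, `(x, t) ↦ 𝒦 t x (y, s)` is `C^∞` on `M × (s, T)` with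
`∂ₜ 𝒦 t x (y, s) = Δ_{h(t)}(𝒦 t · (y, s))(x)`;
(3) for every `s ∈ (a, T)`, `((x, t), y) ↦ 𝒦 t x (y, s)` is continuous on `(M × (s, T]) × M`;
(4) reproduction: for `a < s < r < t ≤ T`,
`𝒦 t x (y, s) = ∫ 𝒦 r z (y, s) dν_{x,t;r}(z) = ∫ 𝒦 t x (z, r) 𝒦 r z (y, s) dV_{h(r)}(z)`.
[cite: Bamler2020Entropy, §2.3] -/
theorem IsRicciFlow.exists_heatKernelFn [PreconnectedSpace M] {a T : ℝ}
    (hflow : IsRicciFlow h cov (Icc a T)) :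
    ∃ 𝒦 : ℝ → M → M × ℝ → ℝ,
      (∀ t ∈ Ioc a T,
        (∀ x, ContMDiffOn (I.prod 𝓘(ℝ, ℝ)) 𝓘(ℝ, ℝ) ∞ (𝒦 t x) (univ ×ˢ Ioo a t)) ∧
        (∀ x, ∀ p ∈ univ ×ˢ Ioo a t, 0 < 𝒦 t x p) ∧
        (∀ x, ∀ s ∈ Ioo a t, heatKernelMeasure hh hR t x s =
          (h s).riemVolume.withDensity fun y ↦ ENNReal.ofReal (𝒦 t x (y, s))) ∧
        (∀ x, ∀ p ∈ univ ×ˢ Ioo a t, deriv (fun s ↦ 𝒦 t x (p.1, s)) p.2 =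
          -(h p.2).laplaceBeltrami (fun y ↦ 𝒦 t x (y, p.2)) p.1 +
            (h p.2).scalarCurvatureWith (cov p.2) p.1 * 𝒦 t x p) ∧
        (∀ a' b', a < a' → a' < b' → b' < t → ∃ L : ℝ, ∀ (x x' : M), ∀ p ∈ univ ×ˢ Icc a' b',
          ENNReal.ofReal |𝒦 t x p - 𝒦 t x' p| ≤ ENNReal.ofReal L * (h t).edist (hR t) x x') ∧
        ContinuousOn (fun q : M × (M × ℝ) ↦ 𝒦 t q.1 q.2) (univ ×ˢ (univ ×ˢ Ioo a t))) ∧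
      (∀ s ∈ Ioo a T, ∀ y,
        ContMDiffOn (I.prod 𝓘(ℝ, ℝ)) 𝓘(ℝ, ℝ) ∞ (fun p : M × ℝ ↦ 𝒦 p.2 p.1 (y, s))
          (univ ×ˢ Ioo s T) ∧
        ∀ p ∈ (univ : Set M) ×ˢ Ioo s T, deriv (fun t ↦ 𝒦 t p.1 (y, s)) p.2 =
          (h p.2).laplaceBeltrami (fun x ↦ 𝒦 p.2 x (y, s)) p.1) ∧
      (∀ s ∈ Ioo a T, ContinuousOn (fun q : (M × ℝ) × M ↦ 𝒦 q.1.2 q.1.1 (q.2, s))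
        ((univ ×ˢ Ioc s T) ×ˢ univ)) ∧
      (∀ r t, a < r → r < t → t ≤ T → ∀ x, ∀ s ∈ Ioo a r, ∀ y,
        𝒦 t x (y, s) = ∫ z, 𝒦 r z (y, s) ∂(heatKernelMeasure hh hR t x r) ∧
        𝒦 t x (y, s) = ∫ z, 𝒦 t x (z, r) * 𝒦 r z (y, s) ∂(h r).riemVolume) := by
  obtain ⟨𝒦, h𝒦⟩ := hflow.exists_conjugateHeatKernel_timeFamily hh hR
  have h𝒦0 : ∀ t ∈ Ioc a T, ∀ x, ∀ p ∈ univ ×ˢ Ioo a t, 0 ≤ 𝒦 t x p :=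
    fun t ht x p hp ↦ ((h𝒦 t ht).2.1 x p hp).le
  have h𝒦ν := fun t (ht : t ∈ Ioc a T) ↦ (h𝒦 t ht).2.2.1
  have h𝒦c := fun t (ht : t ∈ Ioc a T) ↦ (h𝒦 t ht).2.2.2.2.2
  refine ⟨𝒦, h𝒦, fun s hs y ↦ ?_, fun s hs ↦ ?_, fun r t har hrt htT x s hs y ↦ ?_⟩
  · exact contMDiffOn_and_deriv_conjugateHeatKernel_timeFamily_basePoint hh hR h𝒦0 h𝒦ν h𝒦c hs y
  · exact continuousOn_conjugateHeatKernel_timeFamily hh hR h𝒦0 h𝒦ν h𝒦c hs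
  · have ht : t ∈ Ioc a T := ⟨har.trans hrt, htT⟩
    have hr : r ∈ Ioc a T := ⟨har, (hrt.le.trans htT)⟩
    exact ⟨conjugateHeatKernel_family_reproduction hh hR hrt (h𝒦0 t ht) (h𝒦ν t ht) (h𝒦c t ht)
        (h𝒦0 r hr) (h𝒦ν r hr) (h𝒦c r hr) x hs y,
      conjugateHeatKernel_family_semigroup hh hR har hrt (h𝒦0 t ht) (h𝒦ν t ht) (h𝒦c t ht)
        (h𝒦0 r hr) (h𝒦ν r hr) (h𝒦c r hr) x hs y⟩

end HeatKernelFn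

end Literature.Geometry.Riemannian

end
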